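import Summits.CriticalPhenomena.PercolationContinuityZ3.Theorems.SahiMasterFamilyPrincipalCapDichotomy

/-!
# The sparse end of Sahi's hierarchy, IX: the BOTTOM CRITERION at every inclusion-minimal common configuration (all orders)

Support file of the master-family programme (crux `NoHeavyLowerTail`, stmt-CriticalPhenomena-4575; cell `prim-masterthm`, seat P4,
unit `prim-masterthm-p4-g5`).  Seat document HOME/prim-masterthm-p4/CORNERS.md (corner theorem).

Gen 4's sparse-end theorem and `SahiMasterFamilySparseEndLimit` look at the MINIMUM-SIZE common configurations of the events.  For the
identically-zero programme ((EQI-k), master-conj's `T_k`) one wants the criterion at EVERY inclusion-minimal common configuration `c`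
("BOTTOM at the corner `c`"): the coefficient of the monomial `∏_{e∈c} p_e` of `E_k(μ_p; U)` is `Λ'(F^{(c)}) ≥ 0`, and if it is positive
then `E_k` is not identically zero.  This file proves the latter for all orders without polynomial bookkeeping, by realising the
deletion minor `p_e = 0 (e ∉ c)` as the product weight `spw (cInd c) p` (intensity `p` on `c`, `0` off `c`):

* `sahiE_congr_support` — Sahi's functional depends only on the functions restricted to the support of the weight;
* `cylExt U c` — the cylinder extension of the traces (`a ↦ [a ∩ c ∈ U_i]`): up-closed, `∅ ∉`, PRINCIPAL-CAP at `c` whenever `c` is an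
  inclusion-minimal common configuration, with the same traces on `2^c` (`Fc_cylExt`), and the same functional under `spw (cInd c) p`
  (`sahiE_spw_cInd_eq_cylExt`);
* **`exists_pos_forall_sahiE_pos_of_lambdaSys_pos_minimal`** — if `Λ'(F^{(c)}) > 0` at an inclusion-minimal common configuration `c`,
  then `E_{n+1}(spw (cInd c) p; 1_U) > 0` for all `p ∈ (0, δ)`; hence (`exists_sahiE_spw_ne_zero_of_lambdaSys_pos_minimal`) `E_{n+1}`
  is not identically zero over product weights.
HONEST FRAMING: a criterion for NON-vanishing (one direction of (EQI-k)); Sahi `C_k` / Kahn Conj. 5 / the master theorem remain open.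
[this work]
-/

namespace Summit.CriticalPhenomena.PercolationContinuityZ3.Theorems

namespace SahiSparseEnd

open Finset Function SahiRepresentativeForm SahiLightAtoms
open Literature.Combinatorics.Sahi2008

/-! ### Sahi's functional only sees the support of the weight -/

section Support

variable {α : Type*} [Fintype α]

/-- `E(f) = E(g)` if `f = g` on the support of the weight. [folklore] -/
theorem ex_congr_support (μ : α → ℝ) {f g : α → ℝ} (h : ∀ x, μ x ≠ 0 → f x = g x) : ex μ f = ex μ g := by
  rw [ex, ex]
  refine sum_congr rfl fun x _ => ?_
  by_cases hx : μ x = 0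
  · rw [hx, zero_mul, zero_mul]
  · rw [h x hx]

/-- **Sahi's functional depends only on the functions restricted to the support of the weight.** [this work] -/
theorem sahiE_congr_support (μ : α → ℝ) :
    ∀ (n : ℕ) (f g : Fin n → α → ℝ), (∀ i x, μ x ≠ 0 → f i x = g i x) → sahiE μ n f = sahiE μ n g
  | 0, _, _, _ => rfl
  | 1, f, g, h => by
    rw [sahiE_one_apply, sahiE_one_apply]
    exact ex_congr_support μ (h 0)
  | n + 2, f, g, h => by
    rw [sahiE_succ_succ, sahiE_succ_succ, ex_congr_support μ (h 0),
      sahiE_congr_support μ (n + 1) (Fin.tail f) (Fin.tail g) fun i x hx => h i.succ x hx]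
    congr 1
    refine sum_congr rfl fun i _ => sahiE_congr_support μ (n + 1) _ _ fun j x hx => ?_
    by_cases hji : j = i
    · subst hji
      rw [update_self, update_self, Pi.mul_apply, Pi.mul_apply]
      show f j.succ x * f 0 x = g j.succ x * g 0 x
      rw [h j.succ x hx, h 0 x hx]
    · rw [update_of_ne hji, update_of_ne hji]
      exact h j.succ x hx

end Support

variable {ι : Type*} [Fintype ι] [DecidableEq ι]

/-! ### The corner weight `spw (cInd c) p` and the cylinder extension of the traces -/

/-- Intensity profile of the corner `c`: `1` on `c`, `0` off `c`. [this work] -/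
def cInd (c : Finset ι) : ι → ℝ := fun e => if e ∈ c then 1 else 0

omit [Fintype ι] in
/-- `cInd c ≥ 0`. [this work] -/
theorem cInd_nonneg (c : Finset ι) (e : ι) : 0 ≤ cInd c e := by
  unfold cInd; split_ifs <;> norm_num

omit [Fintype ι] in
/-- `∏_{e∈c} cInd c e = 1`. [this work] -/
theorem prod_cInd_self (c : Finset ι) : ∏ e ∈ c, cInd c e = 1 :=
  prod_eq_one fun e he => by rw [cInd, if_pos he]

/-- The corner weight is supported on the subsets of `c`. [this work] -/
theorem subset_of_spw_cInd_ne_zero {c : Finset ι} {p : ℝ} {ω : Finset ι} (h : spw (cInd c) p ω ≠ 0) : ω ⊆ c := by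
  intro e he
  by_contra hec
  apply h
  rw [spw]
  refine mul_eq_zero.2 (Or.inl (prod_eq_zero he ?_))
  rw [cInd, if_neg hec, mul_zero]

section Events

variable {n : ℕ} (U : Fin (n + 1) → Finset (Finset ι)) (c : Finset ι)

/-- The CYLINDER EXTENSION of the traces on `2^c`: `a ∈ cylExt U c i ↔ a ∩ c ∈ U i`. [this work] -/
def cylExt (U : Fin (n + 1) → Finset (Finset ι)) (c : Finset ι) : Fin (n + 1) → Finset (Finset ι) :=
  fun i => univ.filter fun a => a ∩ c ∈ U i

variable {U c}

/-- Membership in the cylinder extension. [this work] -/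
theorem mem_cylExt {i : Fin (n + 1)} {a : Finset ι} : a ∈ cylExt U c i ↔ a ∩ c ∈ U i := by
  simp [cylExt]

/-- The cylinder extension is up-closed. [this work] -/
theorem cylExt_up (hU : ∀ i a a', a ∈ U i → a ⊆ a' → a' ∈ U i) (i : Fin (n + 1)) (a a' : Finset ι)
    (ha : a ∈ cylExt U c i) (haa' : a ⊆ a') : a' ∈ cylExt U c i :=
  mem_cylExt.2 (hU i _ _ (mem_cylExt.1 ha) (inter_subset_inter_right haa'))

/-- `∅ ∉ cylExt U c i`. [this work] -/
theorem empty_not_mem_cylExt (h0 : ∀ i, ∅ ∉ U i) (i : Fin (n + 1)) : ∅ ∉ cylExt U c i := fun h =>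
  h0 i (by simpa using mem_cylExt.1 h)

/-- At an inclusion-minimal common configuration `c`, the cylinder extension is PRINCIPAL-CAP at `c`. [this work] -/
theorem cylExt_principalCap (hcU : ∀ i, c ∈ U i) (hmin : ∀ a, a ⊆ c → (∀ i, a ∈ U i) → a = c) :
    IsPrincipalCap (cylExt U c) c := by
  intro a
  constructor
  · intro ha
    have h := hmin (a ∩ c) inter_subset_right fun i => mem_cylExt.1 (ha i)
    exact h ▸ inter_subset_left
  · intro hca i
    exact mem_cylExt.2 (by rw [inter_eq_right.2 hca]; exact hcU i)

/-- The cylinder extension has the same traces on `2^c`. [this work] -/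
theorem Fc_cylExt : Fc (cylExt U c) c = Fc U c := by
  funext i
  ext a
  rw [Fc, Fc, mem_filter, mem_filter, mem_cylExt]
  constructor
  · rintro ⟨h, hac⟩; exact ⟨by rwa [inter_eq_left.2 hac] at h, hac⟩
  · rintro ⟨h, hac⟩; exact ⟨by rwa [inter_eq_left.2 hac], hac⟩

/-- Under the corner weight, the events and their cylinder extensions have the same functional. [this work] -/
theorem sahiE_spw_cInd_eq_cylExt (p : ℝ) :
    sahiE (spw (cInd c) p) (n + 1) (fun i => setInd (U i)) = sahiE (spw (cInd c) p) (n + 1) (fun i => setInd (cylExt U c i)) := by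
  refine sahiE_congr_support _ _ _ _ fun i ω hω => ?_
  have hωc : ω ∩ c = ω := inter_eq_left.2 (subset_of_spw_cInd_ne_zero hω)
  simp only [setInd_apply, mem_cylExt, hωc]

/-! ### The bottom criterion -/

/-- **THE BOTTOM CRITERION (all orders).**  If `c` is an inclusion-minimal common configuration of the increasing events `U_0,…,U_n`
(up-closed, `∅ ∉ U_i`) and the leading coefficient `Λ'(F^{(c)})` of the traces on `2^c` is positive, then under the corner weights
`spw (cInd c) p` (intensity `p` on `c`, `0` off `c`) `E_{n+1}(1_U) > 0` for all sufficiently small `p > 0`. [this work] -/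
theorem exists_pos_forall_sahiE_pos_of_lambdaSys_pos_minimal (hU : ∀ i a a', a ∈ U i → a ⊆ a' → a' ∈ U i) (h0 : ∀ i, ∅ ∉ U i)
    (hcU : ∀ i, c ∈ U i) (hmin : ∀ a, a ⊆ c → (∀ i, a ∈ U i) → a = c) (hΛ : 0 < LambdaSys (Fc U c) c) :
    ∃ δ > 0, ∀ p : ℝ, 0 < p → p < δ → 0 < sahiE (spw (cInd c) p) (n + 1) (fun i => setInd (U i)) := by
  have hpc := cylExt_principalCap hcU hmin
  have hVU := cylExt_up (c := c) hU
  have hV0 := empty_not_mem_cylExt (c := c) h0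
  have hne : (common (cylExt U c)).Nonempty := ⟨c, hpc.self_mem_common⟩
  obtain ⟨δ, hδ, hpos⟩ := exists_pos_forall_sahiE_spw_pos (cylExt U c) hVU (cInd c) hne (by
    rw [sparseE_zero_of_principalCap (cylExt U c) hVU hV0 hpc (cInd c) hne, prod_cInd_self, one_mul, Fc_cylExt]
    exact Int.cast_pos.2 hΛ)
  exact ⟨δ, hδ, fun p hp hpδ => by rw [sahiE_spw_cInd_eq_cylExt]; exact hpos p hp hpδ⟩

/-- Hence `E_{n+1}(1_U)` is NOT identically zero over product weights: some `spw w p` gives a nonzero (indeed positive) value.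
[this work] -/
theorem exists_sahiE_spw_ne_zero_of_lambdaSys_pos_minimal (hU : ∀ i a a', a ∈ U i → a ⊆ a' → a' ∈ U i) (h0 : ∀ i, ∅ ∉ U i)
    (hcU : ∀ i, c ∈ U i) (hmin : ∀ a, a ⊆ c → (∀ i, a ∈ U i) → a = c) (hΛ : 0 < LambdaSys (Fc U c) c) :
    ∃ (w : ι → ℝ) (p : ℝ), (∀ e, 0 ≤ w e) ∧ 0 < p ∧ 0 < sahiE (spw w p) (n + 1) (fun i => setInd (U i)) := by
  obtain ⟨δ, hδ, h⟩ := exists_pos_forall_sahiE_pos_of_lambdaSys_pos_minimal hU h0 hcU hmin hΛ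
  exact ⟨cInd c, δ / 2, cInd_nonneg c, half_pos hδ, h _ (half_pos hδ) (half_lt_self hδ)⟩

end Events

end SahiSparseEnd

end Summit.CriticalPhenomena.PercolationContinuityZ3.Theorems
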